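import Literature.NumberTheory.Sieve.QuadraticRootsPrimeModuliDFIGamma0Domain
import Literature.NumberTheory.Automorphic.HyperbolicDirichletForm
import Literature.NumberTheory.Automorphic.MaassFormZeroMode
import HarnessLib

/-!
# Euclidean discs in `ℍ`, transfer of local norms, and folding (DFI 1995, Prop. 4, support file)

Topic `Literature/NumberTheory/Sieve`.  Support file of the elementary proof of Proposition 4 of
W. Duke, J. B. Friedlander, H. Iwaniec, *Equidistribution of roots of a quadratic congruence to
prime moduli*, Ann. of Math. 141 (1995).  The pointwise bound for the Poincaré series `P` of (14)
(which the paper takes from the pre-trace formula, Prop. 3, p. 431) is obtained in this series of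
files from a local Sobolev inequality in a Euclidean disc around the point, followed by *folding*
the disc onto a fundamental domain of `Γ₀(q)`.  This file provides the hyperbolic side:

* `isCompact_coe_preimage_closedBall`, `measurableSet_coe_preimage_closedBall` — the part of `ℍ`
  over a closed Euclidean disc `B̄(c, r)`, `r < Im c`;
* `setLIntegral_closedBall_enorm_sq_le`, `setLIntegral_closedBall_laplacian_enorm_sq_le` — the
  Euclidean `L²`-norms over `B̄(c, r)` of `u ∘ ofComplex` and of its coordinate Laplacian are
  bounded by `(Im c + r)²`, resp. `(Im c - r)⁻²`, times the hyperbolic `L²`-norms of `u`,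
  resp. `Δu`, over the same disc (`dμ = y⁻² dx dy`, `Δ = y² (∂ₓ² + ∂ᵧ²)`);
* `setLIntegral_comp_smul_le_of_multiplicity` — **folding**: for a `Γ₀(q)`-invariant `G ≥ 0`,
  `σ ∈ SL₂(ℤ)` and a measurable `S ⊆ ℍ` met at most `M` times by every `SL₂(ℤ)`-orbit,
  `∫_S G(σ z) dμ ≤ (M/2) ∫_F G dμ` for every fundamental domain `F` of `Γ₀(q)`;
* `exists_multiplicity_discs` — one `M` serves all discs `B̄(z₀, r)` with `z₀` in a fixed box.

Standard (Iwaniec, *Spectral methods*, §§1.1, 2.1, 3.2); nothing of the paper is formalised here.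

## References

* W. Duke, J. B. Friedlander, H. Iwaniec, Ann. of Math. (2) 141 (1995), 423–441, Prop. 3–4.
  [cite: DukeFriedlanderIwaniec1995, §3]
* H. Iwaniec, *Spectral Methods of Automorphic Forms*, GSM 53 (2002), (1.8), §2.1, §3.2.
  [cite: Iwaniec2002, §3.2]
-/

noncomputable section

namespace Literature.NumberTheory.Sieve

open _root_.MeasureTheory _root_.Set _root_.Filter _root_.Complex _root_.UpperHalfPlane
open _root_.Literature.NumberTheory.Automorphic
open scoped Real Topology ENNReal NNReal Modular MatrixGroups Pointwise

namespace DFI1995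

/-! ### Euclidean discs inside `ℍ` -/

/-- A closed disc `B̄(c, r)` with `r < Im c` lies in the open upper half-plane. [folklore] -/
theorem im_pos_of_mem_closedBall {c w : ℂ} {r : ℝ} (h : r < c.im) (hw : w ∈ Metric.closedBall c r) :
    0 < w.im ∧ c.im - r ≤ w.im ∧ w.im ≤ c.im + r := by
  rw [Metric.mem_closedBall, dist_eq_norm] at hw
  have h1 := (Complex.abs_im_le_norm (w - c)).trans hw
  rw [Complex.sub_im, abs_le] at h1
  refine ⟨by linarith [h1.1], by linarith [h1.1], by linarith [h1.2]⟩

/-- `B̄(c, r) ⊆ range (ℍ → ℂ)` for `r < Im c`. [folklore] -/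
theorem closedBall_subset_range_coe {c : ℂ} {r : ℝ} (h : r < c.im) :
    Metric.closedBall c r ⊆ range ((↑) : ℍ → ℂ) := fun w hw =>
  ⟨⟨w, (im_pos_of_mem_closedBall h hw).1⟩, rfl⟩

/-- The part of `ℍ` over `B̄(c, r)`, `r < Im c`, is compact. [folklore] -/
theorem isCompact_coe_preimage_closedBall {c : ℂ} {r : ℝ} (h : r < c.im) :
    IsCompact {z : ℍ | (z : ℂ) ∈ Metric.closedBall c r} :=
  UpperHalfPlane.isOpenEmbedding_coe.isInducing.isCompact_preimage' (isCompact_closedBall c r)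
    (closedBall_subset_range_coe h)

/-- The part of `ℍ` over `B̄(c, r)` is measurable. [folklore] -/
theorem measurableSet_coe_preimage_closedBall (c : ℂ) (r : ℝ) :
    MeasurableSet {z : ℍ | (z : ℂ) ∈ Metric.closedBall c r} :=
  Metric.isClosed_closedBall.measurableSet.preimage UpperHalfPlane.continuous_coe.measurable

/-- Its image in `ℂ` is the disc. [folklore] -/
theorem image_coe_preimage_closedBall {c : ℂ} {r : ℝ} (h : r < c.im) :
    ((↑) : ℍ → ℂ) '' {z : ℍ | (z : ℂ) ∈ Metric.closedBall c r} = Metric.closedBall c r :=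
  image_preimage_eq_of_subset (closedBall_subset_range_coe h)

/-- The hyperbolic density `y⁻²` as `ENNReal.ofReal`. [folklore] -/
theorem hypDensity_eq_ofReal {w : ℂ} (hw : 0 < w.im) :
    (((1 / ‖w.im‖₊) ^ 2 : ℝ≥0) : ℝ≥0∞) = ENNReal.ofReal ((w.im ^ 2)⁻¹) := by
  rw [ENNReal.ofReal, ENNReal.coe_inj]
  apply NNReal.eq
  rw [Real.coe_toNNReal _ (by positivity)]
  simp [Real.nnnorm_of_nonneg hw.le]

/-! ### Transfer of local `L²`-norms from `ℍ` to the plane -/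

/-- **Values**: `∫_{B̄(c,r)} |u|² dA ≤ (Im c + r)² ∫_{B̄(c,r)} |u|² dμ`. [cite: Iwaniec2002, (1.8)] -/
theorem setLIntegral_closedBall_enorm_sq_le {u : ℍ → ℂ} (hum : Measurable u) {c : ℂ} {r : ℝ}
    (h : r < c.im) :
    ∫⁻ w in Metric.closedBall c r, ‖u (ofComplex w)‖ₑ ^ 2 ≤
      ENNReal.ofReal ((c.im + r) ^ 2) * ∫⁻ z in {z : ℍ | (z : ℂ) ∈ Metric.closedBall c r}, ‖u z‖ₑ ^ 2 := by
  rw [setLIntegral_upperHalfPlane (fun z => ‖u z‖ₑ ^ 2) (hum.enorm.pow_const 2)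
    (measurableSet_coe_preimage_closedBall c r), image_coe_preimage_closedBall h,
    ← lintegral_const_mul' _ _ ENNReal.ofReal_ne_top]
  refine setLIntegral_mono' Metric.isClosed_closedBall.measurableSet fun w hw => ?_
  obtain ⟨hw0, hw1, hw2⟩ := im_pos_of_mem_closedBall h hw
  rw [hypDensity_eq_ofReal hw0, mul_comm (‖u (ofComplex w)‖ₑ ^ 2), ← mul_assoc, ← ENNReal.ofReal_mul
    (by positivity)]
  refine le_mul_of_one_le_left bot_le (ENNReal.one_le_ofReal.2 ?_)
  rw [← div_eq_mul_inv, one_le_div (by positivity)]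
  exact pow_le_pow_left₀ hw0.le hw2 2

/-- **Laplacian**: the coordinate Laplacian of `u ∘ ofComplex` at `w` is `(Im w)⁻² Δu(w)`, so
`∫_{B̄(c,r)} |(∂ₓ² + ∂ᵧ²)(u ∘ ofComplex)|² dA ≤ (Im c - r)⁻² ∫_{B̄(c,r)} |Δu|² dμ`.
[cite: Iwaniec2002, (1.8), (1.19)] -/
theorem setLIntegral_closedBall_laplacian_enorm_sq_le {u : ℍ → ℂ} (hu : IsC2 u)
    (hΔm : Measurable (hypLaplacian u)) {c : ℂ} {r : ℝ} (h : r < c.im) :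
    ∫⁻ w in Metric.closedBall c r,
      ‖fderiv ℝ (fun v => fderiv ℝ (u ∘ ofComplex) v 1) w 1 +
        fderiv ℝ (fun v => fderiv ℝ (u ∘ ofComplex) v Complex.I) w Complex.I‖ₑ ^ 2 ≤
      ENNReal.ofReal (((c.im - r) ^ 2)⁻¹) *
        ∫⁻ z in {z : ℍ | (z : ℂ) ∈ Metric.closedBall c r}, ‖hypLaplacian u z‖ₑ ^ 2 := by
  rw [setLIntegral_upperHalfPlane (fun z => ‖hypLaplacian u z‖ₑ ^ 2) (hΔm.enorm.pow_const 2)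
    (measurableSet_coe_preimage_closedBall c r), image_coe_preimage_closedBall h,
    ← lintegral_const_mul' _ _ ENNReal.ofReal_ne_top]
  refine setLIntegral_mono' Metric.isClosed_closedBall.measurableSet fun w hw => ?_
  obtain ⟨hw0, hw1, hw2⟩ := im_pos_of_mem_closedBall h hw
  have hcr : 0 < c.im - r := by linarith
  -- the coordinate Laplacian through `Δu`
  have hz : (ofComplex w : ℂ) = w := by rw [ofComplex_apply_of_im_pos hw0]
  have him : (ofComplex w).im = w.im := by rw [ofComplex_apply_of_im_pos hw0]; rfl
  have hL := hypLaplacian_eq_fderiv_fderiv hu (ofComplex w)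
  rw [hz, him] at hL
  have hne : ((w.im : ℝ) : ℂ) ^ 2 ≠ 0 := pow_ne_zero 2 (by exact_mod_cast hw0.ne')
  have hcoord : fderiv ℝ (fun v => fderiv ℝ (u ∘ ofComplex) v 1) w 1 +
      fderiv ℝ (fun v => fderiv ℝ (u ∘ ofComplex) v Complex.I) w Complex.I =
      (((w.im ^ 2)⁻¹ : ℝ) : ℂ) * hypLaplacian u (ofComplex w) := by
    rw [hL, ← mul_assoc]
    push_cast
    rw [inv_mul_cancel₀ hne, one_mul]
  have hen : ‖(((w.im ^ 2)⁻¹ : ℝ) : ℂ)‖ₑ = ENNReal.ofReal ((w.im ^ 2)⁻¹) := by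
    rw [← ofReal_norm, Complex.norm_real, Real.norm_of_nonneg (by positivity)]
  rw [hcoord, enorm_mul, mul_pow, hen, hypDensity_eq_ofReal hw0, ← ENNReal.ofReal_pow (by positivity)]
  -- `(y⁻²)² |Δu|² ≤ (Im c - r)⁻² (|Δu|² y⁻²)`
  rw [mul_comm (‖hypLaplacian u (ofComplex w)‖ₑ ^ 2), ← mul_assoc, ← ENNReal.ofReal_mul (by positivity)]
  refine mul_le_mul_left (ENNReal.ofReal_le_ofReal ?_) _
  rw [sq ((w.im ^ 2)⁻¹)]
  refine mul_le_mul_of_nonneg_right ?_ (by positivity)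
  rw [inv_le_inv₀ (by positivity) (by positivity)]
  exact pow_le_pow_left₀ hcr.le hw1 2

/-! ### Folding a translated set onto a fundamental domain of `Γ₀(q)` -/

/-- **Folding.** Let `F` be a fundamental domain of `Γ₀(q)`, `G ≥ 0` measurable and
`Γ₀(q)`-invariant, `S ⊆ ℍ` measurable and met at most `M` times by every `SL₂(ℤ)`-orbit, and
`σ ∈ SL₂(ℤ)`.  Then `∫_S G(σ z) dμ(z) ≤ (M/2) ∫_F G dμ`. [cite: Iwaniec2002, §3.2 (unfolding), PDF p. 42] -/
theorem setLIntegral_comp_smul_le_of_multiplicity {q : ℕ} {F : Set ℍ}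
    (hF : IsHypFundamentalDomain (Gamma0GL q) F) {G : ℍ → ℝ≥0∞} (hG : Measurable G)
    (hinv : ∀ γ ∈ CongruenceSubgroup.Gamma0 q, ∀ z : ℍ, G (γ • z) = G z)
    {S : Set ℍ} (hS : MeasurableSet S) {M : ℕ}
    (hM : ∀ w : ℍ, ∑' γ : (𝒮ℒ : Subgroup (GL (Fin 2) ℝ)), S.indicator (1 : ℍ → ℝ≥0∞) (γ • w) ≤ M)
    (σ : SL(2, ℤ)) :
    ∫⁻ z in S, G (σ • z) ≤ M / 2 * ∫⁻ z in F, G z := by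
  set g : GL (Fin 2) ℝ := Matrix.SpecialLinearGroup.mapGL ℝ σ with hg
  have hsmul : ∀ z : ℍ, g • z = σ • z := fun z => rfl
  -- transport `S ↦ g S`
  have hmp := measurePreserving_smul g (volume : Measure ℍ)
  have hme : MeasurableEmbedding (fun z : ℍ => g • z) := (MeasurableEquiv.smul g).measurableEmbedding
  have h1 : ∫⁻ z in S, G (σ • z) = ∫⁻ z in g • S, G z := by
    have := hmp.setLIntegral_comp_preimage_emb hme G (g • S)
    rw [Set.preimage_smul, inv_smul_smul] at this
    simpa only [hsmul] using this
  rw [h1]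
  have hgS : MeasurableSet (g • S) := hS.const_smul g
  refine setLIntegral_le_of_invariant Gamma0GL_le_range_toGL neg_one_mem_Gamma0GL countable_Gamma0GL
    hF hG (fun γ hγ z => ?_) hgS (M := (M : ℝ≥0∞)) fun w => ?_
  · obtain ⟨γ', hγ', rfl⟩ := mem_Gamma0GL_iff.1 hγ
    exact hinv γ' hγ' z
  · refine (tsum_indicator_smul_le_of_le Gamma0GL_le_modular _ w).trans ?_
    let σ' : (𝒮ℒ : Subgroup (GL (Fin 2) ℝ)) := ⟨g, σ, rfl⟩
    have e : ∀ γ : (𝒮ℒ : Subgroup (GL (Fin 2) ℝ)),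
        (g • S).indicator (1 : ℍ → ℝ≥0∞) (γ • w) = S.indicator (1 : ℍ → ℝ≥0∞) ((σ'⁻¹ * γ) • w) := by
      intro γ
      have hmem : γ • w ∈ g • S ↔ (σ'⁻¹ * γ) • w ∈ S := by
        rw [Set.mem_smul_set_iff_inv_smul_mem, mul_smul]
        rfl
      by_cases hγ : γ • w ∈ g • S
      · rw [indicator_of_mem hγ, indicator_of_mem (hmem.1 hγ)]; rfl
      · rw [indicator_of_notMem hγ, indicator_of_notMem (fun h' => hγ (hmem.2 h'))]
    calc ∑' γ : (𝒮ℒ : Subgroup (GL (Fin 2) ℝ)), (g • S).indicator (1 : ℍ → ℝ≥0∞) (γ • w)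
        = ∑' γ : (𝒮ℒ : Subgroup (GL (Fin 2) ℝ)), S.indicator (1 : ℍ → ℝ≥0∞) ((σ'⁻¹ * γ) • w) :=
          tsum_congr e
      _ = ∑' γ : (𝒮ℒ : Subgroup (GL (Fin 2) ℝ)), S.indicator (1 : ℍ → ℝ≥0∞) (γ • w) :=
          (Equiv.mulLeft σ'⁻¹).tsum_eq (fun γ : (𝒮ℒ : Subgroup (GL (Fin 2) ℝ)) =>
            S.indicator (1 : ℍ → ℝ≥0∞) (γ • w))
      _ ≤ M := hM w

/-! ### One multiplicity constant for all discs around a box -/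

/-- Multiplicities are monotone in the set. [folklore] -/
theorem tsum_indicator_smul_mono {S T : Set ℍ} (hST : S ⊆ T) (w : ℍ) :
    ∑' γ : (𝒮ℒ : Subgroup (GL (Fin 2) ℝ)), S.indicator (1 : ℍ → ℝ≥0∞) (γ • w) ≤
      ∑' γ : (𝒮ℒ : Subgroup (GL (Fin 2) ℝ)), T.indicator (1 : ℍ → ℝ≥0∞) (γ • w) :=
  ENNReal.tsum_le_tsum fun _ => indicator_le_indicator_of_subset hST (fun _ => bot_le) _

/-- **Uniform multiplicity of discs.** Given `X` and `0 < r < y₁ ≤ y₂` there is `M ∈ ℕ` such that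
for every `z₀ ∈ ℍ` with `|Re z₀| ≤ X`, `y₁ ≤ Im z₀ ≤ y₂`, every `SL₂(ℤ)`-orbit meets the part of
`ℍ` over `B̄(z₀, r)` at most `M` times. [cite: Iwaniec2002, §2.1, PDF pp. 27–28] -/
theorem exists_multiplicity_discs (X : ℝ) {r y₁ : ℝ} (y₂ : ℝ) (hry : r < y₁) :
    ∃ M : ℕ, ∀ z₀ : ℍ, |z₀.re| ≤ X → y₁ ≤ z₀.im → z₀.im ≤ y₂ → ∀ w : ℍ,
      ∑' γ : (𝒮ℒ : Subgroup (GL (Fin 2) ℝ)),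
        {z : ℍ | (z : ℂ) ∈ Metric.closedBall (z₀ : ℂ) r}.indicator (1 : ℍ → ℝ≥0∞) (γ • w) ≤ M := by
  set K : Set ℍ := {w : ℍ | w.re ∈ Icc (-X - r) (X + r) ∧ w.im ∈ Icc (y₁ - r) (y₂ + r)} with hK
  have hKc : IsCompact K := Literature.NumberTheory.Automorphic.isCompact_box (by linarith)
  obtain ⟨M, hM⟩ := exists_multiplicity_bound hKc
  refine ⟨M, fun z₀ hx h1 h2 w => (tsum_indicator_smul_mono (fun z hz => ?_) w).trans (hM w)⟩
  have hz := hz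
  simp only [mem_setOf_eq, Metric.mem_closedBall, dist_eq_norm] at hz
  have hre := (Complex.abs_re_le_norm ((z : ℂ) - z₀)).trans hz
  have him := (Complex.abs_im_le_norm ((z : ℂ) - z₀)).trans hz
  rw [Complex.sub_re, UpperHalfPlane.coe_re, UpperHalfPlane.coe_re, abs_le] at hre
  rw [Complex.sub_im, UpperHalfPlane.coe_im, UpperHalfPlane.coe_im, abs_le] at him
  rw [abs_le] at hx
  simp only [hK, mem_setOf_eq, mem_Icc]
  refine ⟨⟨by linarith, by linarith⟩, by linarith, by linarith⟩

end DFI1995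

end Literature.NumberTheory.Sieve
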